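import Summits.ResolutionOfSingularities.ResolutionOfSingularities.Theorems.FrobeniusLadderFInjectiveMacaulayficationNewtonChartHonAnyField
import Summits.ResolutionOfSingularities.ResolutionOfSingularities.Theorems.FrobeniusLadderFInjectiveMacaulayficationFHalfRowOfNewtonNondegenerateFree
import HarnessLib

/-!
# GAP-2 «k ≠ k̄»: ★★★ THE CLASS ROW FOR GEOMETRICALLY WEAKLY NON-DEGENERATE ISOLATED HYPERSURFACE SINGULARITIES OVER ANY FIELD OF CHARACTERISTIC `p`
# (crux `FInjectiveMacaulayfication` stmt-ResolutionOfSingularities-15315, chain w45a; seat res-L1-w45a-stub-2 g12, res-L1-w45a-plan-1 GO 2026-08-29T02:44:48Z; any-field twins of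
# res-L1-w45a-stub-3's ✓ `FHalfRowOfNewtonNondegenerate.{affineBlowup_fullCl_over_of_weaklyNondegenerate, affineBlowup_fullCl_of_weaklyNondegenerate, fHalfRow_of_weaklyNondegenerate}`
# (`…FHalfRowOfWeaklyNondegenerate`) with `[IsAlgClosed k]` DROPPED: the one `k = k̄` callee `NewtonChartLemma.hon_of_weaklyNondegenerate` is swapped for this seat's
# `NewtonChartHonAnyField.hon_of_geomWeaklyNondegenerate`, and the hypothesis `hWND` becomes GEOMETRIC — weak non-degeneracy of `map (algebraMap k K) f`, `K ⊇ k` algebraically closed)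

[OURS · L1 W4.5a] Support file (`--supports stmt-ResolutionOfSingularities-15315 --as helper`); def-free; UNCONDITIONAL (the toric cover is explicit data, the F-108 «F-TC»
currency); no named fact; NOT a statement of any manuscript; replaces the role of NO printed item. Nothing of the crux is proved. AI-written (AI review weaker than expert review).

WHY. The registered F-half stub `LocalFullificationFibreAdmGe4Split.LocalFInjectivizationFibreAdmGe4` quantifies over EVERY field `k` of characteristic `p`; the class rows of record are
stated for `k = k̄` only. `IsWeaklyNondegenerateAlong w f` quantifies over `k`-RATIONAL torus points, so over a general field the honest class hypothesis is weak non-degeneracy of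
`map (algebraMap k K) f` over an algebraically closed `K ⊇ k` (GEOMETRIC weak non-degeneracy; for `k = k̄` take `K := k`, `map (algebraMap k k) f = f`). Everything else in the
row engine (`CICertificates.ciCertificates_of_isPrime`, `PointFixableOfCert.affineBlowup_fiClause_over_of_cert`, `FHalfRowOfProductCentre.fHalfConclusion_of_affineBlowup_mul`) was
already field-general. The three theorems below are the originals VERBATIM with `(K)` added, `[IsAlgClosed k]` replaced by `[IsAlgClosed K]`, and the geometric `hWND`:
* §1 `affineBlowup_fullCl_over_of_geomWeaklyNondegenerate`, §2 `affineBlowup_fullCl_of_geomWeaklyNondegenerate`, §3 ★★★ `fHalfRow_of_geomWeaklyNondegenerate` — for ANY field `k`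
  of characteristic `p`, `f` prime & geometrically weakly non-degenerate along every positive weight, `X = V(f)` regular off the origin, and a unimodular monomial chart cover of
  `Bl_{𝔪·K}` refining the dual Newton fan: EVERY blowing up of the point floor of `Spec 𝒪_{X,v}` (`v` = the origin, a `k`-RATIONAL vertex) is cured by some `𝓚 ≠ ⊥` over the
  closed point, ALL of whose blowings up are FULL (indeed REGULAR) at every stalk.
SCOPE CAVEAT (desk, binding): this removes the closure hypothesis AT `k`-RATIONAL VERTICES (the census beds: the vertex is the origin); singular closed points whose residue field is a
proper finite extension of `k` are NOT covered here (base change / descent would be the route) and stay in GAP-2. No `PerfectRing` hypothesis anywhere: `FullCl p` is Frobenius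
closure of parameter ideals of the local ring itself.
[cite: IshiiSingularities2018, Thm. 4.4.23, Lemma 4.4.24, Cor. 4.4.25 (pp. 95–97)] [cite: BoubakriGreuelMarkwig2010, §3 (p. 10)] [cite: GortzWedhorn2020, Prop. 13.91 and (13.19)]
[cite: StacksProject, Tag 0804 and Tag 080A] [cite: Matsumura1987, Thm. 5.3]
-/

-- single-problem summit: the doubled namespace component is forced
set_option linter.dupNamespace false

noncomputable section

open AlgebraicGeometry CategoryTheory Literature.AlgebraicGeometry.Resolution TopologicalSpace IsLocalRing MvPolynomial

namespace Summit.ResolutionOfSingularities.ResolutionOfSingularities.Theorems.FInjectiveMacaulayfication.FHalfRowAnyField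

open Summit.ResolutionOfSingularities.ResolutionOfSingularities.Theorems.FInjectiveMacaulayfication
open Literature.AlgebraicGeometry.Resolution.BoubakriGreuelMarkwig SliceableCentre

variable (p : ℕ) [Fact p.Prime] (k : Type) [Field k] [CharP k p] (K : Type) [Field K] [Algebra k K] [IsAlgClosed K] {n : ℕ}

/-! ## §1 Over the origin -/

set_option maxHeartbeats 800000 in
-- the engine's binder block is large; instantiation is by name
/-- ★★ **EVERY STALK OF `Bl_{I_A} X` OVER THE ORIGIN IS FULL, ANY FIELD** for `f` GEOMETRICALLY weakly non-degenerate along every positive weight and a toric cover refining its dual Newton fan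
(presentation `k[X]/(Set.range Fs)`, `Fs = ![f]`): `CICertificates.ciCertificates_of_isPrime` with `hon' := NewtonChartHonAnyField.hon_of_geomWeaklyNondegenerate`, then
`PointFixableOfCert.affineBlowup_fiClause_over_of_cert`; ANY field `k` of characteristic `p`, `K ⊇ k` algebraically closed, `map (algebraMap k K) f` weakly non-degenerate
along every positive weight. (`…FHalfRowOfWeaklyNondegenerate` §1 verbatim, `[IsAlgClosed k]` dropped, callee swapped.) [OURS; cite: IshiiSingularities2018, Lemma 4.4.24; StacksProject, Tag 0804] -/
theorem affineBlowup_fullCl_over_of_geomWeaklyNondegenerate (Fs : Fin 1 → MvPolynomial (Fin n) k) (f : MvPolynomial (Fin n) k) (hFs : Fs = ![f]) (hfp : Prime f)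
    (hWND : ∀ w : Fin n → ℝ, (∀ i, 0 < w i) →
      IsWeaklyNondegenerateAlong w ((map (algebraMap k K) f : MvPolynomial (Fin n) K) : MvPowerSeries (Fin n) K))
    (hXne : ∀ v : Fin n, Ideal.Quotient.mk (Ideal.span (Set.range Fs)) (X v) ≠ 0)
    (A : Finset (Fin n →₀ ℕ)) (hprim : ∀ j ∈ (Finset.univ : Finset (Fin n)), ∃ N : ℕ, Finsupp.single j N ∈ A)
    (t : ℕ) (m : Fin t → (Fin n →₀ ℕ))
    (hcov : ∀ a ∈ A, ∃ (c : Fin t) (K : ℕ), 1 ≤ K ∧ ∃ y ∈ (Ideal.span ((fun b : Fin n →₀ ℕ => (MvPolynomial.monomial b (1 : k) : MvPolynomial (Fin n) k)) '' (A : Set (Fin n →₀ ℕ)))) ^ (K - 1),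
      (MvPolynomial.monomial a (1 : k) : MvPolynomial (Fin n) k) ^ K = MvPolynomial.monomial (m c) 1 * y)
    (V : Fin t → Matrix (Fin n) (Fin n) ℕ) (hV : ∀ c, IsUnit ((V c).map (Nat.cast : ℕ → ℤ)).det)
    (a : Fin t → Fin n → (Fin n →₀ ℕ)) (haA : ∀ c i, a c i ∈ A)
    (hgen : ∀ (c : Fin t) (i : Fin n), (Finsupp.equivFunOnFinite.symm ((V c).mulVec ⇑(a c i)) : Fin n →₀ ℕ) =
      Finsupp.equivFunOnFinite.symm ((V c).mulVec ⇑(m c)) + Finsupp.single i 1)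
    (hge : ∀ (c : Fin t), ∀ e ∈ A, (Finsupp.equivFunOnFinite.symm ((V c).mulVec ⇑(m c)) : Fin n →₀ ℕ) ≤ Finsupp.equivFunOnFinite.symm ((V c).mulVec ⇑e))
    (g : Fin t → MvPolynomial (Fin n) k) (d : Fin t → (Fin n →₀ ℕ))
    (hθ : ∀ c, aeval (fun j : Fin n => ∏ i : Fin n, (X i : MvPolynomial (Fin n) k) ^ V c i j) f = monomial (d c) 1 * g c)
    (hg0 : ∀ c, constantCoeff (g c) ≠ 0)
    (hv : ∀ c : Fin t, Ideal.Quotient.mk (Ideal.span (Set.range Fs)) (monomial (m c) (1 : k)) ∈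
      Ideal.span ((fun e : Fin n →₀ ℕ => Ideal.Quotient.mk (Ideal.span (Set.range Fs)) (monomial e (1 : k))) '' (A : Set (Fin n →₀ ℕ)))) :
    ∀ y : ↥(affineBlowup (Ideal.span ((fun e : Fin n →₀ ℕ => Ideal.Quotient.mk (Ideal.span (Set.range Fs)) (monomial e (1 : k))) '' (A : Set (Fin n →₀ ℕ))))),
      Ideal.span ((fun e : Fin n →₀ ℕ => Ideal.Quotient.mk (Ideal.span (Set.range Fs)) (monomial e (1 : k))) '' (A : Set (Fin n →₀ ℕ))) ≤
        ((affineBlowup.π (Ideal.span ((fun e : Fin n →₀ ℕ => Ideal.Quotient.mk (Ideal.span (Set.range Fs)) (monomial e (1 : k))) '' (A : Set (Fin n →₀ ℕ))))).base y).asIdeal →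
      FullCl p ((affineBlowup (Ideal.span ((fun e : Fin n →₀ ℕ => Ideal.Quotient.mk (Ideal.span (Set.range Fs)) (monomial e (1 : k))) '' (A : Set (Fin n →₀ ℕ))))).presheaf.stalk y) := by
  classical
  subst hFs
  have hr : Set.range (![f] : Fin 1 → MvPolynomial (Fin n) k) = {f} := LevelTwoBlockTranslate.range_vec_one f
  haveI hpr : (Ideal.span (Set.range (![f] : Fin 1 → MvPolynomial (Fin n) k))).IsPrime := by
    rw [hr]; exact (Ideal.span_singleton_prime hfp.ne_zero).mpr hfp
  haveI : IsDomain (MvPolynomial (Fin n) k ⧸ Ideal.span (Set.range (![f] : Fin 1 → MvPolynomial (Fin n) k))) := Ideal.Quotient.isDomain _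
  haveI : CharP (MvPolynomial (Fin n) k ⧸ Ideal.span (Set.range (![f] : Fin 1 → MvPolynomial (Fin n) k))) p :=
    charP_of_injective_algebraMap (algebraMap k _).injective p
  have hθF' : ∀ (c : Fin t) (l : Fin 1), aeval (fun j : Fin n => ∏ i : Fin n, (X i : MvPolynomial (Fin n) k) ^ V c i j)
      ((![f] : Fin 1 → MvPolynomial (Fin n) k) l) = monomial ((fun (c : Fin t) (_ : Fin 1) => d c) c l) (1 : k) * (fun c : Fin t => (![g c] : Fin 1 → MvPolynomial (Fin n) k)) c l := by
    intro c l
    fin_cases l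
    exact hθ c
  obtain ⟨hcovR, hv0, hon'⟩ := CICertificates.ciCertificates_of_isPrime p k Finset.univ A hprim t m hcov V hV a haA hgen hge (![f] : Fin 1 → MvPolynomial (Fin n) k) hpr hXne
    (fun c : Fin t => (![g c] : Fin 1 → MvPolynomial (Fin n) k)) (fun (c : Fin t) (_ : Fin 1) => d c) hθF'
    (NewtonChartHonAnyField.hon_of_geomWeaklyNondegenerate K p f hWND t V hV g d hθ hg0) hv
  intro y hy
  exact PointFixableOfCert.affineBlowup_fiClause_over_of_cert p _ _ t _ hv hcovR hv0 hon' y hy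

/-! ## §2 Everywhere -/

set_option maxHeartbeats 800000 in
-- presentation rewrite + one blow-up-is-iso transport
/-- ★★ **EVERY STALK OF `Bl_{I_A} X` IS FULL, ANY FIELD** (presentation `k[X]/(f)`), geometric Tjurina version: over the origin by §1; elsewhere `X` is regular (`hreg`) and the blowing up is a local
isomorphism over the complement of `V(I_A) = {origin}`. (`…FHalfRowOfWeaklyNondegenerate` §2 verbatim, `[IsAlgClosed k]` dropped; any field `k`, geometric `hWND`.) [OURS; cite: GortzWedhorn2020, Prop. 13.91; StacksProject, Tag 0804] -/
theorem affineBlowup_fullCl_of_geomWeaklyNondegenerate (f : MvPolynomial (Fin n) k) (hfp : Prime f)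
    (hWND : ∀ w : Fin n → ℝ, (∀ i, 0 < w i) →
      IsWeaklyNondegenerateAlong w ((map (algebraMap k K) f : MvPolynomial (Fin n) K) : MvPowerSeries (Fin n) K))
    (hXne : ∀ v : Fin n, Ideal.Quotient.mk (Ideal.span {f}) (X v) ≠ 0)
    (hreg : ∀ x : Spec (.of (MvPolynomial (Fin n) k ⧸ Ideal.span {f})),
      ¬ Ideal.span (Set.range fun j : Fin n => Ideal.Quotient.mk (Ideal.span {f}) (X j)) ≤ x.asIdeal → IsRegularLocalRing (Localization.AtPrime x.asIdeal))
    (A : Finset (Fin n →₀ ℕ)) (hprim : ∀ j ∈ (Finset.univ : Finset (Fin n)), ∃ N : ℕ, Finsupp.single j N ∈ A)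
    (hAJ : ∀ a ∈ A, ∃ j ∈ (Finset.univ : Finset (Fin n)), 0 < a j)
    (t : ℕ) (m : Fin t → (Fin n →₀ ℕ))
    (hcov : ∀ a ∈ A, ∃ (c : Fin t) (K : ℕ), 1 ≤ K ∧ ∃ y ∈ (Ideal.span ((fun b : Fin n →₀ ℕ => (MvPolynomial.monomial b (1 : k) : MvPolynomial (Fin n) k)) '' (A : Set (Fin n →₀ ℕ)))) ^ (K - 1),
      (MvPolynomial.monomial a (1 : k) : MvPolynomial (Fin n) k) ^ K = MvPolynomial.monomial (m c) 1 * y)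
    (V : Fin t → Matrix (Fin n) (Fin n) ℕ) (hV : ∀ c, IsUnit ((V c).map (Nat.cast : ℕ → ℤ)).det)
    (a : Fin t → Fin n → (Fin n →₀ ℕ)) (haA : ∀ c i, a c i ∈ A)
    (hgen : ∀ (c : Fin t) (i : Fin n), (Finsupp.equivFunOnFinite.symm ((V c).mulVec ⇑(a c i)) : Fin n →₀ ℕ) =
      Finsupp.equivFunOnFinite.symm ((V c).mulVec ⇑(m c)) + Finsupp.single i 1)
    (hge : ∀ (c : Fin t), ∀ e ∈ A, (Finsupp.equivFunOnFinite.symm ((V c).mulVec ⇑(m c)) : Fin n →₀ ℕ) ≤ Finsupp.equivFunOnFinite.symm ((V c).mulVec ⇑e))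
    (g : Fin t → MvPolynomial (Fin n) k) (d : Fin t → (Fin n →₀ ℕ))
    (hθ : ∀ c, aeval (fun j : Fin n => ∏ i : Fin n, (X i : MvPolynomial (Fin n) k) ^ V c i j) f = monomial (d c) 1 * g c)
    (hg0 : ∀ c, constantCoeff (g c) ≠ 0)
    (hv : ∀ c : Fin t, Ideal.Quotient.mk (Ideal.span {f}) (monomial (m c) (1 : k)) ∈
      Ideal.span ((fun e : Fin n →₀ ℕ => Ideal.Quotient.mk (Ideal.span {f}) (monomial e (1 : k))) '' (A : Set (Fin n →₀ ℕ)))) :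
    ∀ y : ↥(affineBlowup (Ideal.span ((fun e : Fin n →₀ ℕ => Ideal.Quotient.mk (Ideal.span {f}) (monomial e (1 : k))) '' (A : Set (Fin n →₀ ℕ))))),
      FullCl p ((affineBlowup (Ideal.span ((fun e : Fin n →₀ ℕ => Ideal.Quotient.mk (Ideal.span {f}) (monomial e (1 : k))) '' (A : Set (Fin n →₀ ℕ))))).presheaf.stalk y) := by
  classical
  -- §1 in the presentation `k[X]/(f)`
  have hXne' : ∀ v : Fin n, Ideal.Quotient.mk (Ideal.span (Set.range (![f] : Fin 1 → MvPolynomial (Fin n) k))) (X v) ≠ 0 := by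
    rw [LevelTwoBlockTranslate.range_vec_one]; exact hXne
  have hv' : ∀ c : Fin t, Ideal.Quotient.mk (Ideal.span (Set.range (![f] : Fin 1 → MvPolynomial (Fin n) k))) (monomial (m c) (1 : k)) ∈
      Ideal.span ((fun e : Fin n →₀ ℕ => Ideal.Quotient.mk (Ideal.span (Set.range (![f] : Fin 1 → MvPolynomial (Fin n) k))) (monomial e (1 : k))) '' (A : Set (Fin n →₀ ℕ))) := by
    rw [LevelTwoBlockTranslate.range_vec_one]; exact hv
  have hover := affineBlowup_fullCl_over_of_geomWeaklyNondegenerate p k K (![f]) f rfl hfp hWND hXne' A hprim t m hcov V hV a haA hgen hge g d hθ hg0 hv'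
  rw [LevelTwoBlockTranslate.range_vec_one] at hover
  haveI hfprime : (Ideal.span {f}).IsPrime := (Ideal.span_singleton_prime hfp.ne_zero).mpr hfp
  haveI : IsDomain (MvPolynomial (Fin n) k ⧸ Ideal.span {f}) := Ideal.Quotient.isDomain _
  set I : Ideal (MvPolynomial (Fin n) k ⧸ Ideal.span {f}) :=
    Ideal.span ((fun e : Fin n →₀ ℕ => Ideal.Quotient.mk (Ideal.span {f}) (monomial e (1 : k))) '' (A : Set (Fin n →₀ ℕ))) with hI
  intro y
  by_cases hy : I ≤ ((affineBlowup.π I).base y).asIdeal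
  · exact hover y hy
  · -- off the origin: `X` regular there and `π` an isomorphism over the complement of `V(I) = {origin}`
    have hvert : ¬ Ideal.span (Set.range fun j : Fin n => Ideal.Quotient.mk (Ideal.span {f}) (X j)) ≤ ((affineBlowup.π I).base y).asIdeal := by
      intro hle
      exact hy ((CICertificates.centre_le_iff (Ideal.span {f}) Finset.univ A hAJ hprim _).mpr fun j _ => hle (Ideal.subset_span ⟨j, rfl⟩))
    have hregy : (affineBlowup.π I).base y ∈ Scheme.regularLocus (Spec (.of (MvPolynomial (Fin n) k ⧸ Ideal.span {f}))) :=
      FermatCubicConeGerm.mem_regularLocus_Spec_of_isRegularLocalRing _ (hreg _ hvert)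
    have hsupp : (affineBlowup.π I).base y ∉ ((affineBlowup.idealSheaf I).support : Set (Spec (.of (MvPolynomial (Fin n) k ⧸ Ideal.span {f})))) := by
      rw [affineBlowup.support_idealSheaf]
      exact fun h => hy fun r hr => h hr
    haveI := (affineBlowup.isBlowup I).isIso_compl
    let U : (Spec (.of (MvPolynomial (Fin n) k ⧸ Ideal.span {f}))).Opens :=
      ⟨((affineBlowup.idealSheaf I).support : Set (Spec (.of (MvPolynomial (Fin n) k ⧸ Ideal.span {f}))))ᶜ,
        (affineBlowup.idealSheaf I).support.isClosed.isOpen_compl⟩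
    have hyU : (affineBlowup.π I).base y ∈ U := hsupp
    have hreg' : y ∈ Scheme.regularLocus (affineBlowup I) :=
      (mem_regularLocus_iff_of_isIso_morphismRestrict (affineBlowup.π I) U y hyU).mpr hregy
    rw [Scheme.mem_regularLocus] at hreg'
    haveI := hreg'
    haveI := FTemkinClosedPoints.charP_stalk_of_over p
      (Spec.map (CommRingCat.ofHom (algebraMap k (MvPolynomial (Fin n) k ⧸ Ideal.span {f})))) (affineBlowup.π I) y
    exact FTemkinClosedPoints.fullCl_of_isRegularLocalRing p _

/-! ## §3 ★★★ The row: the point floor of every WEAKLY non-degenerate isolated hypersurface singularity is CURED -/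

set_option maxHeartbeats 800000 in
-- one product rewrite + the p618085 row export
/-- ★★★ **THE CLASS ROW OVER ANY FIELD OF CHARACTERISTIC `p`.** `k` ANY field of characteristic `p`, `K ⊇ k` algebraically closed; `f ∈ k[X_0..X_{n-1}]` (`n ≥ 1`) prime, with `map (algebraMap k K) f` WEAKLY non-degenerate along every positive
weight (the Tjurina ideal of every initial form has no torus zero — satisfied by every `z^p + …` bed of the census, (C)), no variable a multiple of `f` (`hXne`), `X = Spec k[X]/(f)`
REGULAR OFF THE ORIGIN `v` (`hreg`); toric cover data in the currency of rows #3–#5 / F-108 for a monomial centre `I_A = 𝔪·K_A` whose charts refine the dual Newton fan of `f`.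
THEN **for EVERY blowing up `g : S′ → Spec 𝒪_{X,v}` along the POINT FLOOR there is `𝓚 ≠ ⊥` on `S′`, supported over the closed point, such that EVERY blowing up of `S′` along
`𝓚` is FULL AT EVERY STALK** — the F-half's conclusion, in fact with REGULAR stalks. (`…FHalfRowOfWeaklyNondegenerate` §3 verbatim, `[IsAlgClosed k]` dropped; ANY field `k` of characteristic `p`, geometric `hWND`; the vertex `v` is the `k`-RATIONAL origin — singular closed points with residue field a proper extension of `k` are NOT covered here.)
[OURS · assembly; cite: IshiiSingularities2018, Thm. 4.4.23 and Cor. 4.4.25; GortzWedhorn2020, Prop. 13.92 and (13.19); StacksProject, Tag 080A] -/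
theorem fHalfRow_of_geomWeaklyNondegenerate (hn : 0 < n) (f : MvPolynomial (Fin n) k) (hfp : Prime f)
    (hWND : ∀ w : Fin n → ℝ, (∀ i, 0 < w i) →
      IsWeaklyNondegenerateAlong w ((map (algebraMap k K) f : MvPolynomial (Fin n) K) : MvPowerSeries (Fin n) K))
    (hXne : ∀ v : Fin n, Ideal.Quotient.mk (Ideal.span {f}) (X v) ≠ 0)
    (hreg : ∀ x : Spec (.of (MvPolynomial (Fin n) k ⧸ Ideal.span {f})),
      ¬ Ideal.span (Set.range fun j : Fin n => Ideal.Quotient.mk (Ideal.span {f}) (X j)) ≤ x.asIdeal → IsRegularLocalRing (Localization.AtPrime x.asIdeal))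
    (A KA : Finset (Fin n →₀ ℕ))
    (hIA : Ideal.span ((fun e : Fin n →₀ ℕ => Ideal.Quotient.mk (Ideal.span {f}) (monomial e (1 : k))) '' (A : Set (Fin n →₀ ℕ))) =
      Ideal.span (Set.range fun j : Fin n => Ideal.Quotient.mk (Ideal.span {f}) (X j)) *
        Ideal.span ((fun e : Fin n →₀ ℕ => Ideal.Quotient.mk (Ideal.span {f}) (monomial e (1 : k))) '' (KA : Set (Fin n →₀ ℕ))))
    (hKprim : ∀ j : Fin n, ∃ N : ℕ, Finsupp.single j N ∈ KA)
    (hprim : ∀ j ∈ (Finset.univ : Finset (Fin n)), ∃ N : ℕ, Finsupp.single j N ∈ A)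
    (hAJ : ∀ a ∈ A, ∃ j ∈ (Finset.univ : Finset (Fin n)), 0 < a j)
    (t : ℕ) (m : Fin t → (Fin n →₀ ℕ))
    (hcov : ∀ a ∈ A, ∃ (c : Fin t) (K : ℕ), 1 ≤ K ∧ ∃ y ∈ (Ideal.span ((fun b : Fin n →₀ ℕ => (MvPolynomial.monomial b (1 : k) : MvPolynomial (Fin n) k)) '' (A : Set (Fin n →₀ ℕ)))) ^ (K - 1),
      (MvPolynomial.monomial a (1 : k) : MvPolynomial (Fin n) k) ^ K = MvPolynomial.monomial (m c) 1 * y)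
    (V : Fin t → Matrix (Fin n) (Fin n) ℕ) (hV : ∀ c, IsUnit ((V c).map (Nat.cast : ℕ → ℤ)).det)
    (a : Fin t → Fin n → (Fin n →₀ ℕ)) (haA : ∀ c i, a c i ∈ A)
    (hgen : ∀ (c : Fin t) (i : Fin n), (Finsupp.equivFunOnFinite.symm ((V c).mulVec ⇑(a c i)) : Fin n →₀ ℕ) =
      Finsupp.equivFunOnFinite.symm ((V c).mulVec ⇑(m c)) + Finsupp.single i 1)
    (hge : ∀ (c : Fin t), ∀ e ∈ A, (Finsupp.equivFunOnFinite.symm ((V c).mulVec ⇑(m c)) : Fin n →₀ ℕ) ≤ Finsupp.equivFunOnFinite.symm ((V c).mulVec ⇑e))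
    (g : Fin t → MvPolynomial (Fin n) k) (d : Fin t → (Fin n →₀ ℕ))
    (hθ : ∀ c, aeval (fun j : Fin n => ∏ i : Fin n, (X i : MvPolynomial (Fin n) k) ^ V c i j) f = monomial (d c) 1 * g c)
    (hg0 : ∀ c, constantCoeff (g c) ≠ 0)
    (hv : ∀ c : Fin t, Ideal.Quotient.mk (Ideal.span {f}) (monomial (m c) (1 : k)) ∈
      Ideal.span ((fun e : Fin n →₀ ℕ => Ideal.Quotient.mk (Ideal.span {f}) (monomial e (1 : k))) '' (A : Set (Fin n →₀ ℕ))))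
    (v : Spec (.of (MvPolynomial (Fin n) k ⧸ Ideal.span {f})))
    (hvm : v.asIdeal = Ideal.span (Set.range fun j : Fin n => Ideal.Quotient.mk (Ideal.span {f}) (X j))) :
    ∀ (S' : Scheme.{0}) (gS : S' ⟶ Spec ((Spec (.of (MvPolynomial (Fin n) k ⧸ Ideal.span {f}))).presheaf.stalk v)),
      IsBlowup gS ((affineBlowup.idealSheaf (Ideal.span (Set.range fun j : Fin n => Ideal.Quotient.mk (Ideal.span {f}) (X j)))).comap
        ((Spec (.of (MvPolynomial (Fin n) k ⧸ Ideal.span {f}))).fromSpecStalk v)) →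
      ∃ 𝓚 : S'.IdealSheafData, 𝓚 ≠ ⊥ ∧
        (∀ s ∈ (𝓚.support : Set S'), gS.base s = closedPoint ((Spec (.of (MvPolynomial (Fin n) k ⧸ Ideal.span {f}))).presheaf.stalk v)) ∧
        ∀ (S'' : Scheme.{0}) (π : S'' ⟶ S'), IsBlowup π 𝓚 → ∀ s : S'', FullCl p (S''.presheaf.stalk s) := by
  classical
  haveI hfprime : (Ideal.span {f}).IsPrime := (Ideal.span_singleton_prime hfp.ne_zero).mpr hfp
  haveI : IsDomain (MvPolynomial (Fin n) k ⧸ Ideal.span {f}) := Ideal.Quotient.isDomain _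
  have hmono : ∀ e : Fin n →₀ ℕ, Ideal.Quotient.mk (Ideal.span {f}) (monomial e (1 : k)) ≠ 0 := fun e =>
    CIConeFiModelCore.mk_monomial_ne_zero (Ideal.span {f}) hXne e
  -- `τ = 𝔪 ≠ ⊥`, `K ≠ ⊥`, `v ⊆ √K`
  have hτ : Ideal.span (Set.range fun j : Fin n => Ideal.Quotient.mk (Ideal.span {f}) (X j)) ≠ ⊥ := fun h0 =>
    hXne ⟨0, hn⟩ ((Submodule.eq_bot_iff _).mp h0 _ (Ideal.subset_span ⟨⟨0, hn⟩, rfl⟩))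
  have hK : Ideal.span ((fun e : Fin n →₀ ℕ => Ideal.Quotient.mk (Ideal.span {f}) (monomial e (1 : k))) '' (KA : Set (Fin n →₀ ℕ))) ≠ ⊥ := by
    intro h0
    obtain ⟨N, hN⟩ := hKprim ⟨0, hn⟩
    exact hmono _ ((Submodule.eq_bot_iff _).mp h0 _ (Ideal.subset_span ⟨_, hN, rfl⟩))
  have hvK : v.asIdeal ≤ (Ideal.span ((fun e : Fin n →₀ ℕ => Ideal.Quotient.mk (Ideal.span {f}) (monomial e (1 : k))) '' (KA : Set (Fin n →₀ ℕ)))).radical := by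
    rw [hvm, Ideal.span_le]
    rintro _ ⟨j, rfl⟩
    obtain ⟨N, hN⟩ := hKprim j
    exact ⟨N, by rw [← map_pow, X_pow_eq_monomial]; exact Ideal.subset_span ⟨_, hN, rfl⟩⟩
  have hrow : ∀ y : ↥(affineBlowup (Ideal.span (Set.range fun j : Fin n => Ideal.Quotient.mk (Ideal.span {f}) (X j)) *
      Ideal.span ((fun e : Fin n →₀ ℕ => Ideal.Quotient.mk (Ideal.span {f}) (monomial e (1 : k))) '' (KA : Set (Fin n →₀ ℕ))))),
      FullCl p ((affineBlowup (Ideal.span (Set.range fun j : Fin n => Ideal.Quotient.mk (Ideal.span {f}) (X j)) *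
        Ideal.span ((fun e : Fin n →₀ ℕ => Ideal.Quotient.mk (Ideal.span {f}) (monomial e (1 : k))) '' (KA : Set (Fin n →₀ ℕ))))).presheaf.stalk y) := by
    rw [← hIA]
    exact affineBlowup_fullCl_of_geomWeaklyNondegenerate p k K f hfp hWND hXne hreg A hprim hAJ t m hcov V hV a haA hgen hge g d hθ hg0 hv
  exact FHalfRowOfProductCentre.fHalfConclusion_of_affineBlowup_mul p _ _ hτ hK v hvK hrow

end Summit.ResolutionOfSingularities.ResolutionOfSingularities.Theorems.FInjectiveMacaulayfication.FHalfRowAnyField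

end
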